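import Summits.Ventures.PackingBounds.ThreePointCert.CheckIdKSMSound

/-!
# Transposed multi-point check of the identity `(ii')` — points `(2^{wD}, 2^w, τ)` (layout ks5, identities)

Framing: lottery ticket; floor = certified bounds/negative ranges. Venture `PackingBounds`
(cell `pub-packcert`), three-point SDP family — kernel-checking infrastructure (lp gen 13).

`CheckIdKSM.idIIAtF w D τ` decides the value of the identity polynomial `qII c P ρ` at the point
`(2^w, 2^{wD}, τ)` from the rows' `(a, b, c)`-sorted flat leaves with the grouped evaluator
`evF/evFs`: a run of equal `(a, b)` accumulates `Σ coeff·τ^c` (small), every run is flushed once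
with the weight `x_b^{b}` and every `a`-block once with `x_a^{a}`. With `x_a = 2^w`, `x_b = 2^{wD}`
the LARGE weight (`w·D·b` bits, up to ≈ 675 kbit at three-point degree 17) enters at each of the
≈ 1.3–1.7·10⁴ run flushes of a point, and the kernel retains those numbers; at the TRANSPOSED
point `(2^{wD}, 2^w, τ)` it enters only at the ≈ 10³ `a`-block flushes, the run flushes carry
`2^{w·b}` (`≤ w·D` bits). Same number of leaf traversals (`D` points), same data, same static
check (`CheckIdKSM.idIIStatic`, the rows' `CheckIdS` files): only the point theorems change, to
`idIIAtG (2^{wD}) (2^w) τ …` (`idIIAtG` = `idIIAtF`'s body with the two substituted values as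
parameters; `idIIAtF w D τ = idIIAtG (2^w) (2^{wD}) τ` by `rfl`).
Measured on the check pool (K13d16 data, degree 16, `D = 33`, 2026-08-23): one point 64–69 s
either way (the leaf traversal dominates); a file of FIVE original points is killed on the pool
node (twice), a file of five transposed points passes (330 s).
Soundness `idCheckII_of_pointsT`: `CheckKSM.eval_eq_zero_of_kronecker_points` applied to
`permBAC (qII c P ρ)` (exponent boxes and coefficient mass are invariant under the swap `a ↔ b`,
`evalZ (permBAC q) (2^w) (2^{wD}) τ = evalZ q (2^{wD}) (2^w) τ`), then `CheckIdKS.valII_eq` as in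
`CheckIdKSMSound.idCheckII_of_pointsF`. No statement about certificates changes: a row keeps
`theorem cert_idII : idCheckII w D cert polys rhoII = true`, and `card_le_of_cert3KS` consumes it.
-/

noncomputable section

namespace Summit.Ventures.PackingBounds.ThreePointCert

open Literature.Geometry.DiscreteGeometry Literature.Geometry.DiscreteGeometry.PolyCert
open Literature.Geometry.DiscreteGeometry.PolyCert.SPoly

/-! ### Kernel program (`Nat` arithmetic only) -/

/-- **The value check of `(ii')` at the point `(X, Y, τ)`, flat data** (cf. `idIIAtF`). -/
def idIIAtG (X Y τ : ℕ) (c : Cert3) (FPc E0c E1c E2c E3c E4c ρc : List (List ℤ))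
    (s0 s1 s2 s3 s4 : ℕ) : Bool :=
  withEvF X Y τ FPc fun fP fN =>
  withEvF X Y τ E0c fun aP aN =>
  withEvF X Y τ ρc fun rP rN =>
  withEv X Y τ (gqU c.p c.q) fun gP gN =>
  withEvF X Y τ E1c fun bP bN =>
  withEv Y X τ (gqU c.p c.q) fun hP hN =>
  withEvF Y X τ E1c fun iP iN =>
  withEv τ Y X (gqU c.p c.q) fun jP jN =>
  withEvF τ Y X E1c fun kP kN =>
  withEv X Y τ (m2G c.p c.q) fun lP lN =>
  withEvF X Y τ E2c fun mP mN =>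
  withEv X Y τ (m3G c.p c.q) fun oP oN =>
  withEvF X Y τ E3c fun sP sN =>
  withEv X Y τ p4 fun xP xN =>
  withEvF X Y τ E4c fun yP yN =>
    Nat.beq
      (Nat.add (Nat.add (Nat.add (Nat.add (Nat.add (Nat.add (Nat.add (Nat.add (Nat.add (Nat.add
        c.B22 c.c0) fP) (Nat.mul s0 aP)) rP) (mulPP gP gN (Nat.mul s1 bP) (Nat.mul s1 bN)))
        (mulPP hP hN (Nat.mul s1 iP) (Nat.mul s1 iN))) (mulPP jP jN (Nat.mul s1 kP) (Nat.mul s1 kN)))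
        (mulPP lP lN (Nat.mul s2 mP) (Nat.mul s2 mN))) (mulPP oP oN (Nat.mul s3 sP) (Nat.mul s3 sN)))
        (mulPP xP xN (Nat.mul s4 yP) (Nat.mul s4 yN)))
      (Nat.add (Nat.add (Nat.add (Nat.add (Nat.add (Nat.add (Nat.add (Nat.add
        fN (Nat.mul s0 aN)) rN) (mulPN gP gN (Nat.mul s1 bP) (Nat.mul s1 bN)))
        (mulPN hP hN (Nat.mul s1 iP) (Nat.mul s1 iN))) (mulPN jP jN (Nat.mul s1 kP) (Nat.mul s1 kN)))
        (mulPN lP lN (Nat.mul s2 mP) (Nat.mul s2 mN))) (mulPN oP oN (Nat.mul s3 sP) (Nat.mul s3 sN)))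
        (mulPN xP xN (Nat.mul s4 yP) (Nat.mul s4 yN)))

/-- `idIIAtF` is `idIIAtG` at `(2^w, 2^{wD}, τ)`. -/
theorem idIIAtF_eq_idIIAtG (w D τ : ℕ) (c : Cert3) (FPc E0c E1c E2c E3c E4c ρc : List (List ℤ))
    (s0 s1 s2 s3 s4 : ℕ) :
    idIIAtF w D τ c FPc E0c E1c E2c E3c E4c ρc s0 s1 s2 s3 s4 =
      idIIAtG (2 ^ w) (2 ^ (w * D)) τ c FPc E0c E1c E2c E3c E4c ρc s0 s1 s2 s3 s4 := rfl

/-! ### Soundness -/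

/-- The flat value check at `(X, Y, τ)` gives `qII = 0` there. -/
theorem evalZ_qII_of_idIIAtG (X Y τ : ℕ) (c : Cert3) (P : CertPolys3) (ρ : SPoly)
    (FPc E0c E1c E2c E3c E4c ρc : List (List ℤ)) (s0 s1 s2 s3 s4 : ℕ)
    (eFP : P.FP = polyOfChunks FPc) (e0 : P.E0 = smul (s0 : ℤ) (polyOfChunks E0c))
    (e1 : P.E1 = smul (s1 : ℤ) (polyOfChunks E1c)) (e2 : P.E2 = smul (s2 : ℤ) (polyOfChunks E2c))
    (e3 : P.E3 = smul (s3 : ℤ) (polyOfChunks E3c)) (e4 : P.E4 = smul (s4 : ℤ) (polyOfChunks E4c))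
    (eρ : ρ = polyOfChunks ρc)
    (h : idIIAtG X Y τ c FPc E0c E1c E2c E3c E4c ρc s0 s1 s2 s3 s4 = true) :
    evalZ (qII c P ρ) (X : ℤ) (Y : ℤ) (τ : ℤ) = 0 := by
  unfold idIIAtG at h
  simp only [withEvF_eq, withEv_eq, Nat.beq_eq, Nat.add_eq, Nat.mul_eq] at h
  have hZ := congrArg (fun n : ℕ => (n : ℤ)) h
  simp only [Nat.cast_add] at hZ
  simp only [qII, targetII3, rhsG, evalZ_append, evalZ_neg, evalZ_mul, evalZ_permBAC, evalZ_permCBA,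
    evalZ_C]
  rw [eFP, e0, e1, e2, e3, e4, eρ]
  simp only [evalZ_smul]
  have g := fun (xa xb xc : ℕ) (p : SPoly) => ev_sub xa xb xc p
  have f := fun (xa xb xc : ℕ) (ls : List (List ℤ)) => evF_sub xa xb xc ls
  rw [← f _ _ _ FPc, ← f _ _ _ ρc,
    ← g X _ _ (gqU c.p c.q), ← g Y X _ (gqU c.p c.q), ← g τ _ _ (gqU c.p c.q),
    ← g _ _ _ (m2G c.p c.q), ← g _ _ _ (m3G c.p c.q), ← g _ _ _ p4]
  have a0 := smul_parts s0 _ _ _ (f X Y τ E0c)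
  have a1 := smul_parts s1 _ _ _ (f X Y τ E1c)
  have b1 := smul_parts s1 _ _ _ (f Y X τ E1c)
  have c1 := smul_parts s1 _ _ _ (f τ Y X E1c)
  have a2 := smul_parts s2 _ _ _ (f X Y τ E2c)
  have a3 := smul_parts s3 _ _ _ (f X Y τ E3c)
  have a4 := smul_parts s4 _ _ _ (f X Y τ E4c)
  rw [← a0, ← a1, ← b1, ← c1, ← a2, ← a3, ← a4]
  have h1 := mulPP_sub_mulPN (evP X Y τ (gqU c.p c.q)) (evN X Y τ (gqU c.p c.q))
    (s1 * evFP X Y τ E1c) (s1 * evFN X Y τ E1c)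
  have h2 := mulPP_sub_mulPN (evP Y X τ (gqU c.p c.q)) (evN Y X τ (gqU c.p c.q))
    (s1 * evFP Y X τ E1c) (s1 * evFN Y X τ E1c)
  have h3 := mulPP_sub_mulPN (evP τ Y X (gqU c.p c.q)) (evN τ Y X (gqU c.p c.q))
    (s1 * evFP τ Y X E1c) (s1 * evFN τ Y X E1c)
  have h4 := mulPP_sub_mulPN (evP X Y τ (m2G c.p c.q)) (evN X Y τ (m2G c.p c.q))
    (s2 * evFP X Y τ E2c) (s2 * evFN X Y τ E2c)
  have h5 := mulPP_sub_mulPN (evP X Y τ (m3G c.p c.q)) (evN X Y τ (m3G c.p c.q))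
    (s3 * evFP X Y τ E3c) (s3 * evFN X Y τ E3c)
  have h6 := mulPP_sub_mulPN (evP X Y τ p4) (evN X Y τ p4)
    (s4 * evFP X Y τ E4c) (s4 * evFN X Y τ E4c)
  linear_combination -hZ + h1 + h2 + h3 + h4 + h5 + h6

/-- **Soundness of the transposed multi-point identity check on flat data.** -/
theorem idCheckII_of_pointsT (w wm D : ℕ) (c : Cert3) (P : CertPolys3) (ρ : SPoly)
    (FPc E0c E1c E2c E3c E4c ρc : List (List ℤ)) (s0 s1 s2 s3 s4 : ℕ)
    (eFP : P.FP = polyOfChunks FPc) (e0 : P.E0 = smul (s0 : ℤ) (polyOfChunks E0c))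
    (e1 : P.E1 = smul (s1 : ℤ) (polyOfChunks E1c)) (e2 : P.E2 = smul (s2 : ℤ) (polyOfChunks E2c))
    (e3 : P.E3 = smul (s3 : ℤ) (polyOfChunks E3c)) (e4 : P.E4 = smul (s4 : ℤ) (polyOfChunks E4c))
    (eρ : ρ = polyOfChunks ρc)
    (hs : idIIStatic w wm D c P ρ = true)
    (hp : ∀ j : ℕ, j < D →
      idIIAtG (2 ^ (wm * D)) (2 ^ wm) j c FPc E0c E1c E2c E3c E4c ρc s0 s1 s2 s3 s4 = true) :
    idCheckII w D c P ρ = true := by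
  unfold idIIStatic at hs
  simp only [Bool.and_eq_true, decide_eq_true_eq] at hs
  obtain ⟨⟨⟨⟨⟨⟨⟨⟨⟨⟨hD, hFP⟩, h0⟩, h1⟩, h2⟩, h3⟩, h4⟩, hρ⟩, hab⟩, hw⟩, hwm⟩ := hs
  have hbox := exps_qII D c P ρ hD hFP h0 h1 h2 h3 h4 hρ
  have hQ' : ∀ u v t : ℝ, eval (permBAC (qII c P ρ)) u v t = 0 :=
    eval_eq_zero_of_kronecker_points wm D (permBAC (qII c P ρ))
      (fun mc hmc => by
        obtain ⟨x, hx, e⟩ := mem_permBAC_mono _ mc hmc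
        have hb := hbox x hx
        rw [e]; exact ⟨hb.2.1, hb.1, hb.2.2⟩)
      (by rw [(absSum_perms _).1, absSum_qII]; exact hwm)
      (fun j hj => by
        rw [evalZ_permBAC]
        have h := evalZ_qII_of_idIIAtG (2 ^ (wm * D)) (2 ^ wm) j c P ρ FPc E0c E1c E2c E3c E4c ρc
          s0 s1 s2 s3 s4 eFP e0 e1 e2 e3 e4 eρ (hp j hj)
        have hX : (((2 : ℕ) ^ (wm * D) : ℕ) : ℤ) = 2 ^ (wm * D) := by push_cast; rfl
        have hY : (((2 : ℕ) ^ wm : ℕ) : ℤ) = 2 ^ wm := by push_cast; rfl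
        rwa [hX, hY] at h)
  have hQ : ∀ u v t : ℝ, eval (qII c P ρ) u v t = 0 := fun u v t => by
    have h := hQ' v u t
    rwa [eval_permBAC] at h
  have hval : valII w (w * D) (w * D * D) c P ρ = 0 := by
    rw [valII_eq]
    have h := hQ ((2 ^ w : ℤ) : ℝ) ((2 ^ (w * D) : ℤ) : ℝ) ((2 ^ (w * D * D) : ℤ) : ℝ)
    rw [← cast_evalZ] at h
    exact_mod_cast h
  unfold idCheckII
  simp only [Bool.and_eq_true, decide_eq_true_eq]
  exact ⟨⟨⟨⟨⟨⟨⟨⟨⟨⟨hD, hFP⟩, h0⟩, h1⟩, h2⟩, h3⟩, h4⟩, hρ⟩, hab⟩, hw⟩, hval⟩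

end Summit.Ventures.PackingBounds.ThreePointCert

end
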